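import Mathlib
import HarnessLib.Audit
import Summits.PneNP.PneNP.Theorems.PstarGateCaseTPrivateCycleQuad
import Summits.PneNP.PneNP.Theorems.PstarGateChamberAlgebra

/-!
# One GATED chord, CASE T at rank six without the affine hypothesis: both chambers are PINNED (E2 node N4X; prover-1 g20)

FRONTIER range-avoidance ladder, rung F-N3 (`stmt-PneNP-19007`), cell `pnp-ideate` (`PstarGateNodesX.GateCaseTQuadX`); restricted-model proof
complexity — nothing here bears on `P` versus `NP`.

CASE T with another chord `e'` (so `κ₀ = 1`, `D e ∆ D e' = {m₀}` with `m₀ = (u, v₀)`, `PstarGateCaseTStructure`), `Q_{D e}` of rank `≥ 6` on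
`W = coordKer {u}`; chambers `H₁ = {x_u = κ₀ + 1}` (`ℓ = 1`) and `H₀ = {x_u = κ₀}` (`ℓ = 0`); `q = q_mv`, `q⊥ = q_{(1,0)}`, `σ₀` the number of
private reads of the other chords.

* `pin_of_rank_six` — MODEL: if `P` has rank `≥ 6` and vanishes on `Z(q₁)` (`q₁` quadratic) then `q₁ ≡ 1` or `P = q₁` (`forcing_cases`; the
  (EXC) branch is (EQ) by `exc_product_const`, the (NOR) branch contradicts rank six by `nor_not_rank_six`);
* `u_other_eq` — **`u_{e'} = u_e + 1 + x_u·x_{v₀}` everywhere**;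
* `caseT_six_pin_one` — on `H₁`: **`q ≡ 0` or `q = u_e + 1`** ((b) `caseT_q_zero_of_on`: `u_e` vanishes on `H₁ ∩ {q = 1}`);
* `caseT_six_pin_zero` — on `H₀`: **`q ≡ 1` or `q = u_e + x_{v₀}`** ((c) `caseT_forced` at `ℓ = 0`: `u_{e'} = 1` on `H₀ ∩ Z(q)`);
* `caseT_zero_qperp` — on `H₀ ∩ Z(q)`: `q⊥ = σ₀ + 1` (`caseT_fst` at `ℓ = 0`);
* `caseT_six_qperp_zero` — on `H₀`, if `q = u_e + x_{v₀}` there: **`q⊥ ≡ σ₀ + 1` or `q⊥ = u_e + x_{v₀} + σ₀ + 1`** (rigidity).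
-/

set_option linter.dupNamespace false -- `Summit.PneNP.PneNP.…`: summit = sub-problem name (D-0017 single-conjunct layout)

open Finset Module Literature.Computability.Complexity
open scoped symmDiff
open Summit.PneNP.PneNP.Theorems.PstarTyped (Typed)
open Summit.PneNP.PneNP.Theorems.PstarSALevel (varSet bdry BoundaryExpanding SimpleOverlap)
open Summit.PneNP.PneNP.Theorems.PstarCubeIdeals (IsAffineFn IsQuadFn isAffineFn_of_linear)
open Summit.PneNP.PneNP.Theorems.PstarRankRigidity (eq_zero_or_eq_of_rank_six)
open Summit.PneNP.PneNP.Theorems.PstarForcing (forcing_cases exists_ne_of_rank_four)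
open Summit.PneNP.PneNP.Theorems.PstarGateChamberAlgebra (nor_not_rank_six exc_product_const)
open Summit.PneNP.PneNP.Theorems.PstarProductRank (qform polar)
open Summit.PneNP.PneNP.Theorems.PstarQuadRank (rad)
open Summit.PneNP.PneNP.Theorems.PstarQuadRestrict (quad_restrict)
open Summit.PneNP.PneNP.Theorems.PstarPathRankFibre (coordKer mem_coordKer avoid)
open Summit.PneNP.PneNP.Theorems.PstarReadSumset (V2)
open Summit.PneNP.PneNP.Theorems.PstarChordSystem (ChordSystem)
open Summit.PneNP.PneNP.Theorems.PstarChordSystemMap (mapSys toX mapSys_F mapSys_ρ mapSys_ρ' mapSys_t)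
open Summit.PneNP.PneNP.Theorems.PstarChordBridgeTools (privs coef)
open Summit.PneNP.PneNP.Theorems.PstarChordBridge (BridgeData sys Solution Lift)
open Summit.PneNP.PneNP.Theorems.PstarChordBridgeForcing (gam sys_u_eq)
open Summit.PneNP.PneNP.Theorems.PstarChordBridgeBasis (qDir polarDir)
open Summit.PneNP.PneNP.Theorems.PstarChordBridgeCorner (qDir_add)
open Summit.PneNP.PneNP.Theorems.PstarChordBridgeKill (qform_symmDiff)
open Summit.PneNP.PneNP.Theorems.PstarGateBridge (GateHyp)
open Summit.PneNP.PneNP.Theorems.PstarGateCaseT (caseT_forced caseT_fst)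
open Summit.PneNP.PneNP.Theorems.PstarGateCaseTOffQ (toX_fst_of_T)
open Summit.PneNP.PneNP.Theorems.PstarGateCaseTLocal (u_add)
open Summit.PneNP.PneNP.Theorems.PstarGateNodes (GateData)
open Summit.PneNP.PneNP.Theorems.PstarGateNodesX (GateDataX)
open Summit.PneNP.PneNP.Theorems.PstarGateCaseTRankSix (of_chamber sigma_const)
open Summit.PneNP.PneNP.Theorems.PstarGateCaseTPairExc (caseT_coupled)
open Summit.PneNP.PneNP.Theorems.PstarGateCaseTStructure (caseT_through caseT_diff_single)
open Summit.PneNP.PneNP.Theorems.PstarGateCaseTPrivateCycleQuad (caseT_q_zero_of_on)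

namespace Summit.PneNP.PneNP.Theorems.PstarGateCaseTSixPin

/-! ## Model: a rank-six form vanishing on a quadric's zero set -/

section Model

variable {M : Type*} [AddCommGroup M] [Module (ZMod 2) M] [Fintype M] [DecidableEq M]

omit [DecidableEq M] in
/-- **MODEL.**  See the module docstring. -/
theorem pin_of_rank_six {P q₁ : M → ZMod 2} {B B₁ : LinearMap.BilinForm (ZMod 2) M}
    (hP : ∀ x w, P (x + w) = P x + P w + P 0 + B x w) (hq₁ : ∀ x w, q₁ (x + w) = q₁ x + q₁ w + q₁ 0 + B₁ x w)
    (h6 : finrank (ZMod 2) (rad B) + 6 ≤ finrank (ZMod 2) M) (hZ : ∀ w, q₁ w = 0 → P w = 0) :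
    (∀ w, q₁ w = 1) ∨ (∀ w, P w = q₁ w) := by
  classical
  have h4 : finrank (ZMod 2) (rad B) + 4 ≤ finrank (ZMod 2) M := by omega
  have z01 : ∀ t : ZMod 2, t = 0 ∨ t = 1 := by decide
  -- an (EQ) identity `P = q₁ + κ` has `κ = 0` unless `Z(q₁) = ∅`
  have hEQ : ∀ κ : ZMod 2, (∀ w, P w = q₁ w + κ) → (∀ w, q₁ w = 1) ∨ (∀ w, P w = q₁ w) := by
    intro κ hκ
    by_cases hz : ∃ w, q₁ w = 0
    · obtain ⟨w, hw⟩ := hz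
      have hk : κ = 0 := by have h := hκ w; rw [hZ w hw, hw, zero_add] at h; exact h.symm
      exact Or.inr fun w => by rw [hκ w, hk, add_zero]
    · push Not at hz
      exact Or.inl fun w => (z01 (q₁ w)).resolve_left (hz w)
  rcases forcing_cases hq₁ hP h4 (c := 0) hZ with h1 | ⟨κ, hκ⟩ | ⟨ν₁, ν₂, hν₁, hν₂, κ, hE⟩ | ⟨a, b, -, -, m₁, m₂, hm₁, hm₂, hN⟩
  · exact Or.inl h1
  · exact hEQ κ hκ
  · have hc := exc_product_const hP h6 hν₁ hν₂ hE hZ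
    exact hEQ (ν₁ 0 * ν₂ 0 + κ) fun w => by rw [hE w, hc w, add_assoc]
  · exfalso
    have hl : ∀ v : M, IsAffineFn (fun x => B₁ x v + (q₁ v + q₁ 0)) := fun v =>
      isAffineFn_of_linear (B₁.flip v) (q₁ v + q₁ 0)
    exact nor_not_rank_six hP (hl b) (hl a) hm₁ hm₂ hN h6

omit [Fintype M] [DecidableEq M] in
/-- An affine function with a polar form of rank `≥ 1` is contradictory. -/
theorem false_of_affine_of_rank {f : M → ZMod 2} {B : LinearMap.BilinForm (ZMod 2) M} (hf : ∀ x w, f (x + w) = f x + f w + f 0 + B x w)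
    (ha : IsAffineFn f) (h : finrank (ZMod 2) (rad B) + 1 ≤ finrank (ZMod 2) M) : False := by
  have h0 : ∀ x w, B x w = 0 := PstarGateChamberAlgebra.polar_zero_of_affine hf ha
  have htop : rad B = ⊤ := by
    rw [eq_top_iff]
    intro x _
    exact PstarQuadRank.mem_rad.2 (h0 x)
  rw [htop, finrank_top] at h
  omega

end Model

/-! ## Instance level -/

variable {n m : ℕ}

section CaseT

variable (I : LocalMap 4 n m) (hI : I.IsPure xorAndPred) (hT : Typed I) (hS : SimpleOverlap I) {r₀ : ℕ} (hB : BoundaryExpanding r₀ I)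
  {B : BridgeData n m} {e g₀ : Fin m} {u : Fin n} {κ₀ : ZMod 2} (hD : GateDataX I r₀ B e g₀ u κ₀) {mv : V2} (hmvT : mv = (0, 1) ∨ mv = (1, 1))
  (hP : ∀ e' ∈ B.N, e' ≠ e → ∀ a, ((sys I B).ρ e' a = 0 ∨ (sys I B).ρ e' a = mv) ∧ ((sys I B).ρ' e' a = 0 ∨ (sys I B).ρ' e' a = mv))
  (hread : ∀ e' ∈ B.N, e' ≠ e → ∀ a, (sys I B).ρ e' a ≠ 0 ∨ (sys I B).ρ' e' a ≠ 0)
include hI hT hS hB hD hmvT hP hread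

/-- **`u_{e'} = u_e + 1 + x_u x_{v₀}`** for the `u`-edge `m₀ = (u, v₀)` with `D e ∆ D e' = {m₀}`. -/
theorem u_other_eq {e' : Fin m} (he' : e' ∈ B.N) (hne : e' ≠ e) {m₀ : Fin m} (hm₀ : B.D e ∆ B.D e' = {m₀}) {v₀ : Fin n}
    (hv₀ : (I.vars m₀ 2 = u ∧ I.vars m₀ 3 = v₀) ∨ (I.vars m₀ 2 = v₀ ∧ I.vars m₀ 3 = u)) :
    ∀ x : Fin n → ZMod 2, (sys I B).u e' x = (sys I B).u e x + 1 + x u * x v₀ := by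
  classical
  have hκ := (caseT_through I hI hT hS hB hD hmvT hP hread he' hne).2
  -- `Q_{D e'} = Q_{D e} + x_u x_{v₀}`
  have hQ : ∀ x : Fin n → ZMod 2, qform (B.D e') (fun j => I.vars j 2) (fun j => I.vars j 3) x =
      qform (B.D e) (fun j => I.vars j 2) (fun j => I.vars j 3) x + x u * x v₀ := by
    intro x
    have h1 : B.D e' = B.D e ∆ (B.D e ∆ B.D e') := by rw [← symmDiff_assoc, symmDiff_self, bot_symmDiff]
    rw [h1, qform_symmDiff, hm₀]
    unfold qform
    simp only [sum_singleton]
    rcases hv₀ with ⟨h2, h3⟩ | ⟨h2, h3⟩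
    · rw [h2, h3]
    · rw [h2, h3, mul_comm]
  -- the constants: evaluate the coupling at the chamber point `e_u·(κ₀+1)`
  set x₁ : Fin n → ZMod 2 := Pi.single u (κ₀ + 1) with hx₁
  have hcpl := caseT_coupled I hI hT hS hB hD hmvT he' hne (hP e' he' hne) (hread e' he' hne) x₁ (by rw [hx₁, Pi.single_eq_same])
  rw [sys_u_eq, sys_u_eq, hQ, hx₁, Pi.single_eq_same, hκ] at hcpl
  have hγ : gam B e' = gam B e + 1 := by
    have e4 : ∀ g g' Q t : ZMod 2, g' + (Q + (1 + 1) * t) = g + Q + 1 → g' = g + 1 := by decide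
    exact e4 _ _ _ _ hcpl
  intro x
  rw [sys_u_eq, sys_u_eq, hQ, hγ]; ring

/-- **The `H₁` pin at rank six: `q ≡ 0` or `q = u_e + 1` on `H₁`.** -/
theorem caseT_six_pin_one (hN : (B.N.erase e).Nonempty)
    (h6 : finrank (ZMod 2) (rad ((polar (B.D e) (fun j => I.vars j 2) (fun j => I.vars j 3)).restrict (coordKer ({u} : Finset (Fin n))))) + 6 ≤
      finrank (ZMod 2) (coordKer ({u} : Finset (Fin n)))) :
    (∀ x : Fin n → ZMod 2, x u = κ₀ + 1 → qDir I B mv x = 0) ∨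
    (∀ x : Fin n → ZMod 2, x u = κ₀ + 1 → qDir I B mv x = (sys I B).u e x + 1) := by
  classical
  set W : Submodule (ZMod 2) (Fin n → ZMod 2) := coordKer ({u} : Finset (Fin n)) with hWdef
  set x₀ : Fin n → ZMod 2 := Pi.single u (κ₀ + 1) with hx₀
  set P : W → ZMod 2 := fun w => (sys I B).u e (x₀ + (w : Fin n → ZMod 2)) with hPdef
  set q₁ : W → ZMod 2 := fun w => qDir I B mv (x₀ + (w : Fin n → ZMod 2)) + 1 with hq₁def
  have hPq : ∀ v w : W, P (v + w) = P v + P w + P 0 +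
      ((polar (B.D e) (fun j => I.vars j 2) (fun j => I.vars j 3)).restrict W) v w := quad_restrict (u_add I B e) W x₀
  have hq' := quad_restrict (qDir_add I B mv) W x₀
  have hq₁ : ∀ v w : W, q₁ (v + w) = q₁ v + q₁ w + q₁ 0 + ((polarDir I B mv).restrict W) v w := by
    intro v w
    simp only [hq₁def]
    rw [hq' v w]
    generalize qDir I B mv (x₀ + (v : Fin n → ZMod 2)) = a; generalize qDir I B mv (x₀ + (w : Fin n → ZMod 2)) = b
    generalize qDir I B mv (x₀ + ((0 : W) : Fin n → ZMod 2)) = c; generalize ((polarDir I B mv).restrict W) v w = s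
    revert a b c s; decide
  have hwu : ∀ w : W, (x₀ + (w : Fin n → ZMod 2)) u = κ₀ + 1 := fun w => by
    rw [Pi.add_apply, hx₀, Pi.single_eq_same, (mem_coordKer.1 w.2) u (mem_singleton_self u), add_zero]
  have z01 : ∀ t : ZMod 2, t ≠ 1 → t = 0 := by decide
  have hZ : ∀ w, q₁ w = 0 → P w = 0 := by
    intro w hw
    by_contra hPw
    have hP1 : P w = 1 := by revert hPw; generalize P w = t; revert t; decide
    have h := caseT_q_zero_of_on I hI hT hS hB hD hmvT hP hread hN (hwu w) hP1
    simp only [hq₁def] at hw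
    rw [h] at hw
    exact absurd hw (by decide)
  rcases pin_of_rank_six hPq hq₁ h6 hZ with h1 | h2
  · left
    refine of_chamber (S := fun x => qDir I B mv x = 0) fun w => ?_
    have h := h1 w
    simp only [hq₁def] at h
    have e2 : ∀ a : ZMod 2, a + 1 = 1 → a = 0 := by decide
    exact e2 _ h
  · right
    refine of_chamber (S := fun x => qDir I B mv x = (sys I B).u e x + 1) fun w => ?_
    have h := h2 w
    simp only [hq₁def, hPdef] at h
    have e2 : ∀ a b : ZMod 2, a = b + 1 → b = a + 1 := by decide
    exact e2 _ _ h

/-- **The `H₀` pin at rank six: `q ≡ 1` or `q = u_e + x_{v₀}` on `H₀`.** -/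
theorem caseT_six_pin_zero {e' : Fin m} (he' : e' ∈ B.N) (hne : e' ≠ e) {m₀ : Fin m} (hm₀ : B.D e ∆ B.D e' = {m₀}) {v₀ : Fin n}
    (hv₀ : (I.vars m₀ 2 = u ∧ I.vars m₀ 3 = v₀) ∨ (I.vars m₀ 2 = v₀ ∧ I.vars m₀ 3 = u))
    (h6 : finrank (ZMod 2) (rad ((polar (B.D e) (fun j => I.vars j 2) (fun j => I.vars j 3)).restrict (coordKer ({u} : Finset (Fin n))))) + 6 ≤
      finrank (ZMod 2) (coordKer ({u} : Finset (Fin n)))) :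
    (∀ x : Fin n → ZMod 2, x u = κ₀ → qDir I B mv x = 1) ∨
    (∀ x : Fin n → ZMod 2, x u = κ₀ → qDir I B mv x = (sys I B).u e x + x v₀) := by
  classical
  obtain ⟨-, hW, -, -, -, hL, -, -, hG, -, -, -, -, -, -, hcoef, hT3, -⟩ := id hD
  have hκ := (caseT_through I hI hT hS hB hD hmvT hP hread he' hne).2
  have hsub := u_other_eq I hI hT hS hB hD hmvT hP hread he' hne hm₀ hv₀
  have hv₀u : v₀ ≠ u := by
    have h23 : I.vars m₀ 2 ≠ I.vars m₀ 3 := fun h => absurd (hI.2 m₀ h) (by decide)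
    rcases hv₀ with ⟨h2, h3⟩ | ⟨h2, h3⟩
    · rw [← h2, ← h3]; exact h23.symm
    · rw [← h2, ← h3]; exact h23
  set W : Submodule (ZMod 2) (Fin n → ZMod 2) := coordKer ({u} : Finset (Fin n)) with hWdef
  set x₀ : Fin n → ZMod 2 := Pi.single u κ₀ with hx₀
  set P : W → ZMod 2 := fun w => (sys I B).u e (x₀ + (w : Fin n → ZMod 2)) + (w : Fin n → ZMod 2) v₀ with hPdef
  set q₀ : W → ZMod 2 := fun w => qDir I B mv (x₀ + (w : Fin n → ZMod 2)) with hq₀def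
  have hU := quad_restrict (u_add I B e) W x₀
  have hPq : ∀ v w : W, P (v + w) = P v + P w + P 0 +
      ((polar (B.D e) (fun j => I.vars j 2) (fun j => I.vars j 3)).restrict W) v w := by
    intro v w
    simp only [hPdef]
    rw [hU v w, Submodule.coe_add, Submodule.coe_zero, Pi.add_apply, Pi.zero_apply]
    ring
  have hq₀ : ∀ v w : W, q₀ (v + w) = q₀ v + q₀ w + q₀ 0 + ((polarDir I B mv).restrict W) v w := quad_restrict (qDir_add I B mv) W x₀
  have hwu : ∀ w : W, (x₀ + (w : Fin n → ZMod 2)) u = κ₀ := fun w => by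
    rw [Pi.add_apply, hx₀, Pi.single_eq_same, (mem_coordKer.1 w.2) u (mem_singleton_self u), add_zero]
  have hwv : ∀ w : W, (x₀ + (w : Fin n → ZMod 2)) v₀ = (w : Fin n → ZMod 2) v₀ := fun w => by
    rw [Pi.add_apply, hx₀, Pi.single_eq_of_ne hv₀u, zero_add]
  have hZ : ∀ w, q₀ w = 0 → P w = 0 := by
    intro w hw
    have hc0 : coef I B.C₁ B.G₁ (I.vars e 2) (x₀ + (w : Fin n → ZMod 2)) = 0 := by
      rw [hcoef, hwu]; exact CharTwo.add_self_eq_zero κ₀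
    have hx : ((sys I B).u e (x₀ + (w : Fin n → ZMod 2)) = 0 ∧ coef I B.C₁ B.G₁ (I.vars e 2) (x₀ + (w : Fin n → ZMod 2)) = 1) ∨
        qDir I B mv (x₀ + (w : Fin n → ZMod 2)) + (sys I B).u e (x₀ + (w : Fin n → ZMod 2)) * coef I B.C₁ B.G₁ (I.vars e 2) (x₀ + ↑w) = 0 := by
      right; rw [hc0, mul_zero, add_zero]; exact hw
    have hon := caseT_forced I hI hT hW hL hG hT3 hmvT hP hread hx e' he' hne
    have h := hsub (x₀ + (w : Fin n → ZMod 2))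
    rw [sys_u_eq I B e', hon, hwu, hwv, hκ, one_mul] at h
    simp only [hPdef]
    have e3 : ∀ g U t : ZMod 2, g + (g + 1) = U + 1 + t → U + t = 0 := by decide
    exact e3 _ _ _ h
  rcases pin_of_rank_six hPq hq₀ h6 hZ with h1 | h2
  · left
    exact of_chamber (S := fun x => qDir I B mv x = 1) fun w => h1 w
  · right
    refine of_chamber (S := fun x => qDir I B mv x = (sys I B).u e x + x v₀) fun w => ?_
    have h := h2 w
    simp only [hq₀def, hPdef] at h
    rw [hwv]
    exact h.symm

omit hS hB in
/-- **On `H₀ ∩ Z(q)`: `q⊥ = σ₀ + 1`** (the first basis-changed coordinate at `ℓ = 0`). -/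
theorem caseT_zero_qperp {x : Fin n → ZMod 2} (hxu : x u = κ₀) (hq : qDir I B mv x = 0) :
    qDir I B (1, 0) x = 1 + ∑ i ∈ B.N.erase e, (((sys I B).ρ i 0).2 + ((sys I B).ρ' i 0).2) := by
  classical
  obtain ⟨-, hW, -, -, -, hL, -, -, hG, -, -, -, -, -, -, hcoef, hT3, -⟩ := id hD
  have he : e ∈ B.N := hG.1
  have hc0 : coef I B.C₁ B.G₁ (I.vars e 2) x = 0 := by rw [hcoef, hxu]; exact CharTwo.add_self_eq_zero κ₀
  have hx : ((sys I B).u e x = 0 ∧ coef I B.C₁ B.G₁ (I.vars e 2) x = 1) ∨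
      qDir I B mv x + (sys I B).u e x * coef I B.C₁ B.G₁ (I.vars e 2) x = 0 := by
    right; rw [hc0, mul_zero, add_zero]; exact hq
  have hon := caseT_forced I hI hT hW hL hG hT3 hmvT hP hread hx
  have hfst := caseT_fst I hI hT hW hL hG hT3 hmvT hP hx
  simp only [mapSys_F, mapSys_ρ, mapSys_ρ', mapSys_t, ← map_add, toX_fst_of_T hmvT, Prod.snd_add] at hfst
  -- the sum over the ON chords: the gated chord contributes `0`, the others are all ON
  have hsum : ∑ i ∈ B.N.filter (fun i => ¬ (sys I B).u i x = 0), (((sys I B).ρ i x).2 + ((sys I B).ρ' i x).2) =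
      ∑ i ∈ B.N.erase e, (((sys I B).ρ i x).2 + ((sys I B).ρ' i x).2) := by
    have hsub : B.N.erase e ⊆ B.N.filter (fun i => ¬ (sys I B).u i x = 0) := by
      intro i hi
      obtain ⟨hne, hiN⟩ := mem_erase.1 hi
      refine mem_filter.2 ⟨hiN, ?_⟩
      rw [sys_u_eq, hon i hiN hne]
      have e2 : ∀ g : ZMod 2, g + (g + 1) ≠ 0 := by decide
      exact e2 _
    rw [← sum_sdiff hsub]
    have h0 : ∑ i ∈ B.N.filter (fun i => ¬ (sys I B).u i x = 0) \ B.N.erase e, (((sys I B).ρ i x).2 + ((sys I B).ρ' i x).2) = 0 := by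
      refine sum_eq_zero fun i hi => ?_
      obtain ⟨hif, hie⟩ := mem_sdiff.1 hi
      have hiN := (mem_filter.1 hif).1
      have hie' : i = e := by
        by_contra h; exact hie (mem_erase.2 ⟨h, hiN⟩)
      subst hie'
      rw [(PstarGateBridge.gate_reads I hI hG x).1, (PstarGateBridge.gate_reads I hI hG x).2]
      simp
    rw [h0, zero_add]
  rw [hsum, sigma_const I hW hG] at hfst
  unfold PstarChordBridgeBasis.qDir
  simp only [zero_mul, one_mul, zero_add]
  have e3 : ∀ F s t : ZMod 2, F + s = t + 1 → F + t = 1 + s := by decide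
  exact e3 _ _ _ hfst

omit hS hB in
/-- **The `H₀` pin of `q⊥` at rank six**, when `q = u_e + x_{v₀}` on `H₀`. -/
theorem caseT_six_qperp_zero {v₀ : Fin n} (hv₀u : v₀ ≠ u)
    (hq0 : ∀ x : Fin n → ZMod 2, x u = κ₀ → qDir I B mv x = (sys I B).u e x + x v₀)
    (h6 : finrank (ZMod 2) (rad ((polar (B.D e) (fun j => I.vars j 2) (fun j => I.vars j 3)).restrict (coordKer ({u} : Finset (Fin n))))) + 6 ≤
      finrank (ZMod 2) (coordKer ({u} : Finset (Fin n)))) :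
    (∀ x : Fin n → ZMod 2, x u = κ₀ → qDir I B (1, 0) x = 1 + ∑ i ∈ B.N.erase e, (((sys I B).ρ i 0).2 + ((sys I B).ρ' i 0).2)) ∨
    (∀ x : Fin n → ZMod 2, x u = κ₀ →
      qDir I B (1, 0) x = (sys I B).u e x + x v₀ + ∑ i ∈ B.N.erase e, (((sys I B).ρ i 0).2 + ((sys I B).ρ' i 0).2) + 1) := by
  classical
  set σ₀ := ∑ i ∈ B.N.erase e, (((sys I B).ρ i 0).2 + ((sys I B).ρ' i 0).2) with hσ₀
  set W : Submodule (ZMod 2) (Fin n → ZMod 2) := coordKer ({u} : Finset (Fin n)) with hWdef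
  set x₀ : Fin n → ZMod 2 := Pi.single u κ₀ with hx₀
  set P : W → ZMod 2 := fun w => (sys I B).u e (x₀ + (w : Fin n → ZMod 2)) + (w : Fin n → ZMod 2) v₀ with hPdef
  set g : W → ZMod 2 := fun w => qDir I B (1, 0) (x₀ + (w : Fin n → ZMod 2)) + σ₀ + 1 with hgdef
  have hU := quad_restrict (u_add I B e) W x₀
  have hPq : ∀ v w : W, P (v + w) = P v + P w + P 0 +
      ((polar (B.D e) (fun j => I.vars j 2) (fun j => I.vars j 3)).restrict W) v w := by
    intro v w
    simp only [hPdef]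
    rw [hU v w, Submodule.coe_add, Submodule.coe_zero, Pi.add_apply, Pi.zero_apply]
    ring
  have hq' := quad_restrict (qDir_add I B (1, 0)) W x₀
  have hg : IsQuadFn g := by
    refine ⟨(polarDir I B (1, 0)).restrict W, fun v w => ?_⟩
    show qDir I B (1, 0) (x₀ + ((v + w : W) : Fin n → ZMod 2)) + σ₀ + 1 = qDir I B (1, 0) (x₀ + (v : Fin n → ZMod 2)) + σ₀ + 1 +
      (qDir I B (1, 0) (x₀ + (w : Fin n → ZMod 2)) + σ₀ + 1) + (qDir I B (1, 0) (x₀ + ((0 : W) : Fin n → ZMod 2)) + σ₀ + 1) +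
      ((polarDir I B (1, 0)).restrict W) v w
    rw [hq' v w]
    generalize qDir I B (1, 0) (x₀ + (v : Fin n → ZMod 2)) = a; generalize qDir I B (1, 0) (x₀ + (w : Fin n → ZMod 2)) = b
    generalize qDir I B (1, 0) (x₀ + ((0 : W) : Fin n → ZMod 2)) = c
    generalize ((polarDir I B (1, 0)).restrict W) v w = s
    generalize σ₀ = k
    revert a b c s k; decide
  have hwu : ∀ w : W, (x₀ + (w : Fin n → ZMod 2)) u = κ₀ := fun w => by
    rw [Pi.add_apply, hx₀, Pi.single_eq_same, (mem_coordKer.1 w.2) u (mem_singleton_self u), add_zero]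
  have hwv : ∀ w : W, (x₀ + (w : Fin n → ZMod 2)) v₀ = (w : Fin n → ZMod 2) v₀ := fun w => by
    rw [Pi.add_apply, hx₀, Pi.single_eq_of_ne hv₀u, zero_add]
  have hZ : ∀ w, P w = 0 → g w = 0 := by
    intro w hw
    have hq : qDir I B mv (x₀ + (w : Fin n → ZMod 2)) = 0 := by
      rw [hq0 _ (hwu w), hwv]; exact hw
    have h := caseT_zero_qperp I hI hT hD hmvT hP hread (hwu w) hq
    show qDir I B (1, 0) (x₀ + (w : Fin n → ZMod 2)) + σ₀ + 1 = 0
    rw [h, ← hσ₀]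
    generalize σ₀ = k; revert k; decide
  rcases eq_zero_or_eq_of_rank_six hPq h6 hg hZ with h0 | h1
  · left
    refine of_chamber (S := fun x => qDir I B (1, 0) x = 1 + σ₀) fun w => ?_
    have h := h0 w
    simp only [hgdef] at h
    have e2 : ∀ a k : ZMod 2, a + k + 1 = 0 → a = 1 + k := by decide
    exact e2 _ _ h
  · right
    refine of_chamber (S := fun x => qDir I B (1, 0) x = (sys I B).u e x + x v₀ + σ₀ + 1) fun w => ?_
    have h := h1 w
    simp only [hgdef, hPdef] at h
    rw [hwv]
    have e2 : ∀ a k b : ZMod 2, a + k + 1 = b → a = b + k + 1 := by decide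
    exact e2 _ _ _ h

end CaseT

end Summit.PneNP.PneNP.Theorems.PstarGateCaseTSixPin
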